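import Summits.QuantumFields.YangMills.Theorems.BalabanUVNodesN07CritLamTowerClauses
import Summits.QuantumFields.YangMills.Theorems.BalabanUVNodesK0FlatHPinnedExteriorLocality
import HarnessLib

/-!
# N07 [B11] ∕ K0⁷ road, chart side — MODULE 106: **THE REACH CUT-OFF OF THE (d′) LETTER IS INVISIBLE ON THE TOWER** — for the per-cube meet `cubeDomains ⊓ D₂` at the (144) tower,
# every cell of level `≥ 1` REACHES (all fine sites under its two end blocks lie in `π″□₀`), and every level-0 cell that does not reach is FAR PINNED in the sense of MODULE 76, so its
# `flatH`-kernel column vanishes off itself; hence `H_V(𝟙_reach·Bf) = H_V(Bf)` on every bond of `π″□₀` — the head token's `A − H_V(𝟙_reach·QA)` IS the supplier's `A − H_V(Q_V A)` there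

Cell `pub-ymgap`, seat `pub-ymgap-dag-n07-e` g29 (FAN-OUT §N07 row s3; LANE OWNER of the K0 road chart side), MODULE 106 = repair (R3)(e) of ⚑ LOCATED-DPRIME-CALIBRATION (desk memo
2026-08-29).  `--kind proof --supports stmt-QuantumFields-20541 --as helper` (K0⁷); count-neutral; theorems only.  [15] = [Balaban1985Variational]; [6] = [Balaban1985RegularSpaces];
[4] = [Balaban1984PropagatorsII]; [I] = [Balaban1987RG1].

WHY.  The head token's (d′) letter (MODULE 100 :110–176) is `Letters10On (π″box) η t₁ (A − H_V(𝟙_reach·QA))` with `reach c :↔ ∀ x, B^{j(c)}(x) ∈ {c₋, c₊} → x ∈ π″□₀` (MODULE 78's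
bookkeeping: `QA` is only read where the gauge equation (T1) holds), while the supplier (k0-s1 S4) concludes about `⇑X − H_V(Q_V ⇑X)` with the FULL `Q_V`.  MODULE 76
(`…K0FlatHPinnedExteriorLocality.flatH_single_apply_eq_zero_of_far`) proved that the kernel column of `flatH` at a level-0 cell vanishes off the cell whenever its plaquette stencil and
site stencil are pinned and it lies in no higher averaging tube — three DISPLAYED geometric clauses.  This file discharges them at the tower for every level-0 cell with an end point off
`π″□₀` (margins `m₁ + 2 ≤ m₀`, `m_j + Lʲ + 1 ≤ m₀`: `ρ ≥ 3L` suffices, MODULE 104's arithmetic), shows that cells of level `j ≥ 1` reach (their end blocks lie within one `j`-block of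
`□_j`), and concludes the kernel identity `H_V(𝟙_reach·Bf) b = H_V(Bf) b` at every `b` with both ends in `π″□₀`, for ANY datum `Bf` — so with `Bf := Q_V A` (the straight averages of
the matrix field, `bondAvgIter`, = S4's `QV` letter by k0-s1-w1's `K0Stub1FlatChartQlinLetters.bondAvgIter_eq_sum_single_smul` + `QE_apply`) the two (d′) currencies agree on the print box.

WHAT IS PROVED (sorry-free; no definition; axioms standard; `P` a torus of the record; `a M ρ k hk` the tower, `1 ≤ k ≤ m + K`; `D₂` any second family; `Y₀ := π″□₀`).
§1 ★ `cover_mem_cube_zero_of_iterBlockOf_cover_mem` (a cover point within `t` of a point whose `j`-block is a label of `Ω_j^{(j)}` of the cube family covers into `π″□₀` when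
`m_j + t ≤ m₀`), `blockIter_cover_eq_iterBlockOf_cover`; §2 for a level-0 bond `b₀` that does NOT reach (`¬(b₀₋ ∈ Y₀ ∧ b₀₊ ∈ Y₀)`): ★ `plaqStencil_pinned_of_not_reach`,
★ `siteStencil_pinned_of_not_reach`, ★ `tubeFar_of_not_reach` (76's three clauses for the meet), ★★ `flatH_single_eq_zero_of_not_reach` (76 applied: the kernel column at `b₀` vanishes
at every bond of `π″□₀`); §3 ★★ `reach_of_lamBond_pos` (cells of level `≥ 1` reach), ★★★ `kernelH_indicator_reach_eq` (`Σ_c flatH(𝟙_c) b • (if reach c then Bf c else 0) =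
Σ_c flatH(𝟙_c) b • Bf c` at every `b` with both ends in `π″□₀`, any `Bf : BondIdx → M` in a real vector space).
HONEST FRAMING: torus∕lattice bookkeeping by name over MODULES 76 ∕ 104 and n21-e's collars; NOTHING of [15]'s estimates asserted; (d′) ∕ `HThm4RecDbar` ∕ budget row of MODULE 100
untouched; K0⁷ NOT closed; N07 NOT discharged; counts unmoved; one finite 𝕋⁴ programme at fixed ε — NOT continuum ∕ ℝ⁴ ∕ OS ∕ mass gap ∕ Clay.  No `sorry`, no `def`, no
`instance`, no `notation`.

References: [15] (144) p.300, (150)–(153) p.301, (157)–(159) pp.302–303, (162) p.303; [6] p.98, (1.131) p.99; [4] (2.3) p.224, (2.20) p.226, (2.35) p.228; [I] (0.1)–(0.4) pp.251–253.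
-/

set_option autoImplicit false

noncomputable section

open scoped BigOperators

namespace Summit.QuantumFields.YangMills.BalabanUVNodes.N07DPrimeReachDictionary

open Literature.MathematicalPhysics.QuantumFieldTheory.Balaban1983to89
open Literature.MathematicalPhysics.QuantumFieldTheory.Balaban1983to89.B5Eq118OneStroke (iterBlockOf)
open Literature.MathematicalPhysics.QuantumFieldTheory.Balaban1983to89.B6SectADomainsV1 (Domains)
open Literature.MathematicalPhysics.QuantumFieldTheory.Balaban1983to89.B6SectAOperatorsV1 (BondIdx)
open Literature.MathematicalPhysics.QuantumFieldTheory.Balaban1983to89.B14DomainGeom (Pt Within)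
open Literature.MathematicalPhysics.QuantumFieldTheory.Balaban1983to89.B15Eq112TorusCover (cover lift cover_lift)
open Literature.MathematicalPhysics.QuantumFieldTheory.Balaban1983to89.B8Eq131Cubes (cube gs cube_anti)
open Literature.MathematicalPhysics.QuantumFieldTheory.Balaban1983to89.Node00
open Literature.MathematicalPhysics.QuantumLattice (blockMap)
open LatticeFieldCalculus (bondAvgIter)
open Summit.QuantumFields.YangMills.Theorems.N21ReadSetSupport (within_add_single within_sub_single eq_of_shift_eq blockIter_cover_add_single blockIter_cover_sub_single)
open Summit.QuantumFields.YangMills.BalabanUVNodes.N07TowerGaugeCoverLift (blockIter_cover)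
open Summit.QuantumFields.YangMills.BalabanUVNodes.N07CritLamTowerClauses (exists_translate_mem_cube_of_coverAt_eq exists_mem_cube_cover_eq_of_inOm
  mem_cube_zero_of_within margin_one_add_le margin_add_three_pow_le pin_clause_tower corners_mem_of_inOm_one mem_bonds_of_inOm_one within_add_right_iff)
open Summit.QuantumFields.YangMills.Theorems.K0FlatCubeOpsTextP (flatH)
open Summit.QuantumFields.YangMills.Theorems.K0FlatHPinnedExteriorLocality (flatH_single_apply_eq_zero_of_far)

variable {P : Params} {a : Pt P.d} {M ρ k : ℕ} {hk : k ≤ P.m + P.K}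

/-! ## §1  A cover point near a labelled block covers into `π″□₀` -/

/-- r15's `blockIter` and NODE 00's `iterBlockOf` agree on cover points (both are `π_j ∘ ⌊·∕Lʲ⌋`). [cite: Balaban1987RG1, (0.1) p.251 (bookkeeping)] -/
theorem blockIter_cover_eq_iterBlockOf_cover {j : ℕ} (hj : j ≤ P.m + P.K) (x : Pt P.d) :
    B14.Eq22Determines.blockIter j (cover P x) = iterBlockOf j (cover P x) :=
  (blockIter_cover hj x).trans (iterBlockOf_cover hj x).symm

/-- ★ **A COVER POINT NEAR A LABELLED BLOCK COVERS INTO `π″□₀`**: if the `j`-block of `π W` is a label of `Ω_j^{(j)}` of the cube family (`1 ≤ j ≤ k`) and `X′` is within `t` of `W`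
with `m_j + t ≤ m₀`, then `π X′ ∈ π″□₀` (deck translation + collar arithmetic). [cite: Balaban1985RegularSpaces, p.98, (1.131) p.99; Balaban1987RG1, (0.1) p.251] -/
theorem cover_mem_cube_zero_of_iterBlockOf_cover_mem {j : ℕ} (hj : 1 ≤ j) (hjk : j ≤ k) {W X' : Pt P.d} {t : ℕ}
    (hW : iterBlockOf j (cover P W) ∈ (cubeDomains P a M ρ k hk).Om j) (hwithin : Within (t : ℤ) W X')
    (hmargin : P.L ^ j * (ρ * gs P.L (k - j)) + t ≤ ρ * gs P.L k) :
    cover P X' ∈ cover P '' cube P.L a M ρ k 0 := by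
  have h1 : coverAt P j (blockMap (P.L ^ j) W) = iterBlockOf j (cover P W) := (iterBlockOf_cover (hjk.trans hk) W).symm
  obtain ⟨v, hv⟩ := exists_translate_mem_cube_of_coverAt_eq (hk := hk) hj hjk hW h1
  refine ⟨X' + (fun μ => ((P.sitesPerDir 0 : ℕ) : ℤ) * v μ), mem_cube_zero_of_within hjk hmargin hv ((within_add_right_iff _ _ _).2 hwithin), ?_⟩
  rw [← coverAt_zero, coverAt_add_period 0 X' v]

/-! ## §2  A level-0 cell that does not reach is far pinned (MODULE 76's three clauses at the tower) -/

section NotReach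

variable (D₂ : Domains P)

/-- ★ **PLAQUETTE STENCIL PINNED**: if `b₀` does not reach (`¬(b₀₋ ∈ π″□₀ ∧ b₀₊ ∈ π″□₀)`), every plaquette through `b₀` has its four bonds among the level-0 cells of the meet
(a corner in `Ω₁` would put all corners, hence both ends of `b₀`, in `π″□₀`; collar `ρ ≥ 1`). [cite: Balaban1984PropagatorsII, (2.3) p.224; Balaban1985RegularSpaces, p.98] -/
theorem plaqStencil_pinned_of_not_reach (hk1 : 1 ≤ k) (hρ : 1 ≤ ρ) {b₀ : PBond P 0}
    (hnr : ¬ (b₀.src ∈ cover P '' cube P.L a M ρ k 0 ∧ b₀.tgt ∈ cover P '' cube P.L a M ρ k 0)) (p : Plaq P 0)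
    (hp : b₀ = ⟨p.src, p.μ⟩ ∨ b₀ = ⟨p.src.shift p.μ, p.ν⟩ ∨ b₀ = ⟨p.src.shift p.ν, p.μ⟩ ∨ b₀ = ⟨p.src, p.ν⟩) :
    (domainsMeet (cubeDomains P a M ρ k hk) D₂).LamBond 0 ⟨p.src, p.μ⟩ ∧ (domainsMeet (cubeDomains P a M ρ k hk) D₂).LamBond 0 ⟨p.src.shift p.μ, p.ν⟩ ∧
      (domainsMeet (cubeDomains P a M ρ k hk) D₂).LamBond 0 ⟨p.src.shift p.ν, p.μ⟩ ∧ (domainsMeet (cubeDomains P a M ρ k hk) D₂).LamBond 0 ⟨p.src, p.ν⟩ := by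
  have hνμ : (p.src.shift p.ν).shift p.μ = (p.src.shift p.μ).shift p.ν := Site.shift_comm _ _ _
  -- no corner of `p` lies in `Ω₁` of the cube family
  have hno : ∀ x : Site P 0, (x = p.src ∨ x = p.src.shift p.μ ∨ x = p.src.shift p.ν ∨ x = (p.src.shift p.μ).shift p.ν) →
      ¬ (cubeDomains P a M ρ k hk).InOm 1 x := by
    intro x hx hin
    obtain ⟨c0, c1, c2, c3⟩ := corners_mem_of_inOm_one hk1 hρ p hin hx
    have c3' : (p.src.shift p.ν).shift p.μ ∈ cover P '' cube P.L a M ρ k 0 := by rw [hνμ]; exact c3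
    apply hnr
    rcases hp with rfl | rfl | rfl | rfl
    · exact ⟨c0, c1⟩
    · exact ⟨c1, c3⟩
    · exact ⟨c2, c3'⟩
    · exact ⟨c0, c2⟩
  refine ⟨pin_clause_tower a M ρ k hk D₂ _ ?_, pin_clause_tower a M ρ k hk D₂ _ ?_, pin_clause_tower a M ρ k hk D₂ _ ?_, pin_clause_tower a M ρ k hk D₂ _ ?_⟩ <;>
    simp only [Set.mem_setOf_eq, not_or]
  · exact ⟨hno _ (Or.inl rfl), hno _ (Or.inr (Or.inl rfl))⟩
  · exact ⟨hno _ (Or.inr (Or.inl rfl)), hno _ (Or.inr (Or.inr (Or.inr rfl)))⟩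
  · exact ⟨hno _ (Or.inr (Or.inr (Or.inl rfl))), hno _ (Or.inr (Or.inr (Or.inr hνμ)))⟩
  · exact ⟨hno _ (Or.inl rfl), hno _ (Or.inr (Or.inr (Or.inl rfl)))⟩

/-- ★ **SITE STENCIL PINNED**: if `b₀` does not reach, its two end points and all their lattice neighbours are sites of `Λ₀` of the meet (none lies in `Ω₁` of the cube family:
such a site is `π z`, `z ∈ □₁`, and both ends of `b₀` are within `2` of `z`; collar `ρ ≥ 2`). [cite: Balaban1984PropagatorsII, (2.3) p.224; Balaban1985RegularSpaces, p.98] -/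
theorem siteStencil_pinned_of_not_reach (hk1 : 1 ≤ k) (hρ : 2 ≤ ρ) {b₀ : PBond P 0}
    (hnr : ¬ (b₀.src ∈ cover P '' cube P.L a M ρ k 0 ∧ b₀.tgt ∈ cover P '' cube P.L a M ρ k 0)) (x : Site P 0) (hx : x = b₀.src ∨ x = b₀.tgt) :
    (domainsMeet (cubeDomains P a M ρ k hk) D₂).LamSite 0 x ∧
      ∀ μ, (domainsMeet (cubeDomains P a M ρ k hk) D₂).LamSite 0 (x.shift μ) ∧ (domainsMeet (cubeDomains P a M ρ k hk) D₂).LamSite 0 (x.unshift μ) := by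
  have hm : P.L ^ 1 * (ρ * gs P.L (k - 1)) + 2 ≤ ρ * gs P.L k := margin_one_add_le hk1 hρ
  -- if a site `y ∈ Ω₁` has a cover point within `1` of a cover point of `x`, both ends of `b₀` lie in `π″□₀`: contradiction
  have key : ∀ y : Site P 0, (cubeDomains P a M ρ k hk).InOm 1 y →
      (∀ z : Pt P.d, cover P z = y → ∃ z₀ : Pt P.d, cover P z₀ = x ∧ Within ((1 : ℕ) : ℤ) z z₀) → False := by
    intro y hin hnear
    obtain ⟨z, hz, hzy⟩ := exists_mem_cube_cover_eq_of_inOm (hk := hk) le_rfl hk1 hin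
    obtain ⟨z₀, hz₀, hw⟩ := hnear z hzy
    apply hnr
    rcases hx with rfl | rfl
    · refine ⟨?_, ?_⟩
      · exact ⟨z₀, mem_cube_zero_of_within hk1 hm hz (Within.mono (by norm_num) hw), hz₀⟩
      · refine ⟨z₀ + Pi.single b₀.dir 1, mem_cube_zero_of_within hk1 hm hz ?_, ?_⟩
        · have := hw.triangle (within_add_single z₀ b₀.dir zero_le_one); push_cast at this ⊢; exact this
        · rw [B15Claim189CubePin.cover_add_single, hz₀]; rfl
    · refine ⟨?_, ?_⟩
      · refine ⟨z₀ - Pi.single b₀.dir 1, mem_cube_zero_of_within hk1 hm hz ?_, ?_⟩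
        · have := hw.triangle (within_sub_single z₀ b₀.dir zero_le_one); push_cast at this ⊢; exact this
        · apply eq_of_shift_eq (μ := b₀.dir)
          rw [← B15Claim189CubePin.cover_add_single, sub_add_cancel, hz₀]; rfl
      · exact ⟨z₀, mem_cube_zero_of_within hk1 hm hz (Within.mono (by norm_num) hw), hz₀⟩
  have hlam : ∀ y : Site P 0, ¬ (cubeDomains P a M ρ k hk).InOm 1 y → (domainsMeet (cubeDomains P a M ρ k hk) D₂).LamSite 0 y := by
    intro y hy
    rw [Domains.lamSite_zero_iff]
    exact not_deep_of_domainsLe (domainsMeet_le_left _ _) (fun h => hy ((Domains.deep_iterBlockOf_iff _ 0 y).1 h))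
  refine ⟨hlam x (fun hin => key x hin fun z hz => ⟨z, hz, Within.refl (by norm_num) z⟩),
    fun μ => ⟨hlam _ (fun hin => key (x.shift μ) hin fun z hz => ⟨z - Pi.single μ 1, ?_, ?_⟩),
      hlam _ (fun hin => key (x.unshift μ) hin fun z hz => ⟨z + Pi.single μ 1, ?_, ?_⟩)⟩⟩
  · apply eq_of_shift_eq (μ := μ)
    rw [← B15Claim189CubePin.cover_add_single, sub_add_cancel, hz]
  · exact_mod_cast within_sub_single z μ zero_le_one
  · rw [B15Claim189CubePin.cover_add_single, hz, B10StarCount.shift_unshift]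
  · exact_mod_cast within_add_single z μ zero_le_one

/-- ★ **NO HIGHER TUBE**: if `b₀` does not reach, then at every level `j ≥ 1` of the meet the `j`-block `y` of `b₀₋` is not a label of `Ω_j^{(j)}`, no forward neighbour of `y` is,
and `y` is no forward neighbour of a label (each case puts `b₀₋` within `Lʲ` of `□_j` on the cover, hence both ends of `b₀` in `π″□₀`: margin `m_j + Lʲ + 1 ≤ m₀`, `ρ ≥ 3L`).
[cite: Balaban1984PropagatorsI, (1.18) p.20; Balaban1984PropagatorsII, (2.3) p.224; Balaban1985RegularSpaces, p.98] -/
theorem tubeFar_of_not_reach (hρ : 3 * P.L ≤ ρ) {b₀ : PBond P 0}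
    (hnr : ¬ (b₀.src ∈ cover P '' cube P.L a M ρ k 0 ∧ b₀.tgt ∈ cover P '' cube P.L a M ρ k 0)) :
    ∀ j, 1 ≤ j → j ≤ (domainsMeet (cubeDomains P a M ρ k hk) D₂).k →
      iterBlockOf j b₀.src ∉ (domainsMeet (cubeDomains P a M ρ k hk) D₂).Om j ∧
      (∀ μ, (iterBlockOf j b₀.src).shift μ ∉ (domainsMeet (cubeDomains P a M ρ k hk) D₂).Om j) ∧
      (∀ z ∈ (domainsMeet (cubeDomains P a M ρ k hk) D₂).Om j, ∀ μ, z.shift μ ≠ iterBlockOf j b₀.src) := by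
  intro j hj hjK
  have hjk : j ≤ k := hjK.trans (by rw [domainsMeet_k]; exact min_le_left _ _)
  have hjm : j ≤ P.m + P.K := hjk.trans hk
  have hq : 1 ≤ P.L ^ j := Nat.one_le_pow _ _ P.L_pos
  have hq0 : (0 : ℤ) ≤ ((P.L ^ j : ℕ) : ℤ) := by exact_mod_cast Nat.zero_le _
  have hm : P.L ^ j * (ρ * gs P.L (k - j)) + (P.L ^ j + 1) ≤ ρ * gs P.L k := margin_add_three_pow_le hj hjk hρ (by omega)
  obtain ⟨X, hXc⟩ : ∃ X : Pt P.d, cover P X = b₀.src := ⟨lift P b₀.src, cover_lift _⟩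
  -- a cover point `W` within `Lʲ` of `X` whose `j`-block is a label of the cube family puts both ends of `b₀` in `π″□₀`
  have key : ∀ W : Pt P.d, iterBlockOf j (cover P W) ∈ (cubeDomains P a M ρ k hk).Om j → Within ((P.L ^ j : ℕ) : ℤ) W X → False := by
    intro W hW hw
    apply hnr
    refine ⟨?_, ?_⟩
    · have h := cover_mem_cube_zero_of_iterBlockOf_cover_mem (hk := hk) hj hjk (t := P.L ^ j + 1) hW (Within.mono (by push_cast; omega) hw) hm
      rwa [hXc] at h
    · have hw' : Within (((P.L ^ j + 1 : ℕ) : ℤ)) W (X + Pi.single b₀.dir 1) := by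
        have := hw.triangle (within_add_single X b₀.dir zero_le_one); push_cast at this ⊢; exact this
      have h := cover_mem_cube_zero_of_iterBlockOf_cover_mem (hk := hk) hj hjk hW hw' hm
      rwa [B15Claim189CubePin.cover_add_single, hXc] at h
  have hsub : (domainsMeet (cubeDomains P a M ρ k hk) D₂).Om j ⊆ (cubeDomains P a M ρ k hk).Om j := domainsMeet_le_left _ _ j
  have hX0 : iterBlockOf j (cover P X) = iterBlockOf j b₀.src := by rw [hXc]
  refine ⟨fun h => key X (hX0 ▸ hsub h) (Within.refl hq0 X), fun μ h => ?_, fun z hz μ h => ?_⟩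
  · -- forward neighbour: the block of `π(X + Lʲe_μ)`
    have h3 : Within ((P.L ^ j : ℕ) : ℤ) (X + Pi.single μ ((P.L ^ j : ℕ) : ℤ)) X := (within_add_single X μ hq0).symm
    have h1 := blockIter_cover_add_single hjm X μ
    rw [blockIter_cover_eq_iterBlockOf_cover hjm, blockIter_cover_eq_iterBlockOf_cover hjm, hXc] at h1
    have hW : iterBlockOf j (cover P (X + Pi.single μ ((P.L ^ j : ℕ) : ℤ))) ∈ (cubeDomains P a M ρ k hk).Om j := h1 ▸ hsub h
    exact key _ hW h3
  · -- `y` a forward neighbour of a label `z`: `z` is the block of `π(X − Lʲe_μ)`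
    have h3 : Within ((P.L ^ j : ℕ) : ℤ) (X - Pi.single μ ((P.L ^ j : ℕ) : ℤ)) X := (within_sub_single X μ hq0).symm
    have h1 := blockIter_cover_sub_single hjm X μ
    rw [blockIter_cover_eq_iterBlockOf_cover hjm, blockIter_cover_eq_iterBlockOf_cover hjm, hXc, ← h] at h1
    have hz' : iterBlockOf j (cover P (X - Pi.single μ ((P.L ^ j : ℕ) : ℤ))) = z := eq_of_shift_eq h1
    have hW : iterBlockOf j (cover P (X - Pi.single μ ((P.L ^ j : ℕ) : ℤ))) ∈ (cubeDomains P a M ρ k hk).Om j := hz' ▸ hsub hz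
    exact key _ hW h3

/-- ★★ **THE KERNEL COLUMN OF A NON-REACHING LEVEL-0 CELL VANISHES ON `π″□₀`** (MODULE 76 `flatH_single_apply_eq_zero_of_far` with its three clauses discharged): for a level-0 cell
`b₀` of the meet with an end point off `π″□₀` and any bond `b` with both ends in `π″□₀`, `flatH (r·𝟙_{⟨0,b₀⟩}) b = 0` (`1 ≤ k`, `ρ ≥ 3L`).
[cite: Balaban1984PropagatorsII, (2.35) p.228, (2.3) p.224; Balaban1985Variational, (162) p.303; Balaban1985RegularSpaces, p.98] -/
theorem flatH_single_eq_zero_of_not_reach (kf : ℕ) (hk1 : 1 ≤ k) (hρ : 3 * P.L ≤ ρ) {b₀ : PBond P 0}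
    (hb₀ : (domainsMeet (cubeDomains P a M ρ k hk) D₂).LamBond 0 b₀)
    (hnr : ¬ (b₀.src ∈ cover P '' cube P.L a M ρ k 0 ∧ b₀.tgt ∈ cover P '' cube P.L a M ρ k 0)) (r : ℝ)
    {b : PBond P 0} (hb : b.src ∈ cover P '' cube P.L a M ρ k 0 ∧ b.tgt ∈ cover P '' cube P.L a M ρ k 0) :
    flatH P kf (domainsMeet (cubeDomains P a M ρ k hk) D₂) (Pi.single (⟨⟨⟨0, Nat.succ_pos _⟩, b₀⟩, hb₀⟩ : BondIdx _) r) b = 0 := by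
  have hρ1 : 1 ≤ ρ := le_trans (by have := P.L_pos; omega) hρ
  have hρ2 : 2 ≤ ρ := le_trans (by have := P.hL.2; omega) hρ
  have hne : b ≠ b₀ := fun h => hnr (h ▸ hb)
  exact flatH_single_apply_eq_zero_of_far _ kf hb₀ r (plaqStencil_pinned_of_not_reach D₂ hk1 hρ1 hnr)
    (siteStencil_pinned_of_not_reach D₂ hk1 hρ2 hnr) (tubeFar_of_not_reach D₂ hρ hnr) hne

end NotReach

/-! ## §3  Cells of level `≥ 1` reach; the kernel identity -/

section Reach

variable (D₂ : Domains P)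

/-- ★★ **CELLS OF LEVEL `j ≥ 1` REACH**: every fine site under the two end blocks of a meet-cell of level `j ≥ 1` lies in `π″□₀` (one end block is a label of `Ω_j^{(j)} ⊆ π_j(□_j^{(j)})`,
the other is its lattice neighbour; margin `m_j + Lʲ ≤ m₀`, `ρ ≥ 3L`). [cite: Balaban1985RegularSpaces, p.98, (1.131) p.99; Balaban1984PropagatorsII, (2.3) p.224] -/
theorem reach_of_lamBond_pos (hρ : 3 * P.L ≤ ρ) {j : ℕ} (hj : 1 ≤ j) {c : PBond P j}
    (hc : (domainsMeet (cubeDomains P a M ρ k hk) D₂).LamBond j c) (x : Site P 0) (hx : iterBlockOf j x = c.src ∨ iterBlockOf j x = c.tgt) :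
    x ∈ cover P '' cube P.L a M ρ k 0 := by
  have hjK : j ≤ (domainsMeet (cubeDomains P a M ρ k hk) D₂).k := Domains.le_of_lamBond _ hc
  have hjk : j ≤ k := hjK.trans (by rw [domainsMeet_k]; exact min_le_left _ _)
  have hjm : j ≤ P.m + P.K := hjk.trans hk
  have hm : P.L ^ j * (ρ * gs P.L (k - j)) + P.L ^ j ≤ ρ * gs P.L k :=
    margin_add_three_pow_le hj hjk hρ (by have := Nat.one_le_pow j P.L P.L_pos; omega)
  have hq0 : (0 : ℤ) ≤ ((P.L ^ j : ℕ) : ℤ) := by exact_mod_cast Nat.zero_le _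
  have hsub : (domainsMeet (cubeDomains P a M ρ k hk) D₂).Om j ⊆ (cubeDomains P a M ρ k hk).Om j := domainsMeet_le_left _ _ j
  obtain ⟨X, hXc⟩ : ∃ X : Pt P.d, cover P X = x := ⟨lift P x, cover_lift _⟩
  -- a cover point `W` within `Lʲ` of `X` whose `j`-block is a cube label
  have key : ∀ W : Pt P.d, iterBlockOf j (cover P W) ∈ (cubeDomains P a M ρ k hk).Om j → Within ((P.L ^ j : ℕ) : ℤ) W X →
      x ∈ cover P '' cube P.L a M ρ k 0 := by
    intro W hW hw
    have h := cover_mem_cube_zero_of_iterBlockOf_cover_mem (hk := hk) hj hjk hW hw hm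
    rwa [hXc] at h
  have hct : c.tgt = c.src.shift c.dir := rfl
  have hX0 : iterBlockOf j (cover P X) = iterBlockOf j x := by rw [hXc]
  have hadd := blockIter_cover_add_single hjm X c.dir
  have hsub' := blockIter_cover_sub_single hjm X c.dir
  rw [blockIter_cover_eq_iterBlockOf_cover hjm, blockIter_cover_eq_iterBlockOf_cover hjm, hXc] at hadd hsub'
  -- hadd : B^j(π(X + Lʲe)) = B^j(x) + e;  hsub' : B^j(π(X − Lʲe)) + e = B^j(x)
  have h3a : Within ((P.L ^ j : ℕ) : ℤ) (X + Pi.single c.dir ((P.L ^ j : ℕ) : ℤ)) X := (within_add_single X c.dir hq0).symm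
  have h3s : Within ((P.L ^ j : ℕ) : ℤ) (X - Pi.single c.dir ((P.L ^ j : ℕ) : ℤ)) X := (within_sub_single X c.dir hq0).symm
  rcases hc.1 with hs | ht
  · -- `c₋` is a cube label
    rcases hx with h | h
    · exact key X ((hX0.trans h) ▸ hsub hs) (Within.refl hq0 X)
    · -- the block of `x` is `c₊ = c₋ + e`: the block of `π(X − Lʲe)` is `c₋`
      rw [h, hct] at hsub'
      have hz' : iterBlockOf j (cover P (X - Pi.single c.dir ((P.L ^ j : ℕ) : ℤ))) = c.src := eq_of_shift_eq hsub'
      exact key _ (hz' ▸ hsub hs) h3s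
  · -- `c₊` is a cube label
    rcases hx with h | h
    · -- the block of `x` is `c₋`: the block of `π(X + Lʲe)` is `c₊`
      rw [h, ← hct] at hadd
      exact key _ (hadd ▸ hsub ht) h3a
    · exact key X ((hX0.trans h) ▸ hsub ht) (Within.refl hq0 X)

/-- ★★★ **THE REACH CUT-OFF IS INVISIBLE ON `π″□₀`**: for the meet at the tower (`1 ≤ k`, `ρ ≥ 3L`), any datum `Bf` on its index bonds with values in a real vector space, and any
fine bond `b` with both ends in `π″□₀`: `Σ_c flatH(𝟙_c)(b) • (if reach c then Bf c else 0) = Σ_c flatH(𝟙_c)(b) • Bf c` — the kernel reading of the head token's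
`H_V(𝟙_reach·QA) b = H_V(QA) b`. [cite: Balaban1985Variational, (157)–(159) pp.302–303, (162) p.303; Balaban1984PropagatorsII, (2.35) p.228] -/
theorem kernelH_indicator_reach_eq [∀ c : BondIdx (domainsMeet (cubeDomains P a M ρ k hk) D₂), Decidable (∀ x : Site P 0, (iterBlockOf (c.1.1 : ℕ) x = c.1.2.src ∨ iterBlockOf (c.1.1 : ℕ) x = c.1.2.tgt) → x ∈ cover P '' cube P.L a M ρ k 0)] {V : Type*} [AddCommGroup V] [Module ℝ V] (kf : ℕ) (hk1 : 1 ≤ k) (hρ : 3 * P.L ≤ ρ)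
    (Bf : BondIdx (domainsMeet (cubeDomains P a M ρ k hk) D₂) → V)
    {b : PBond P 0} (hb : b.src ∈ cover P '' cube P.L a M ρ k 0 ∧ b.tgt ∈ cover P '' cube P.L a M ρ k 0) :
    (∑ c : BondIdx (domainsMeet (cubeDomains P a M ρ k hk) D₂),
        flatH P kf _ (Pi.single c 1) b •
          (if (∀ x : Site P 0, (iterBlockOf (c.1.1 : ℕ) x = c.1.2.src ∨ iterBlockOf (c.1.1 : ℕ) x = c.1.2.tgt) → x ∈ cover P '' cube P.L a M ρ k 0)
            then Bf c else 0)) =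
      ∑ c : BondIdx (domainsMeet (cubeDomains P a M ρ k hk) D₂), flatH P kf _ (Pi.single c 1) b • Bf c := by
  refine Finset.sum_congr rfl fun c _ => ?_
  by_cases hreach : ∀ x : Site P 0, (iterBlockOf (c.1.1 : ℕ) x = c.1.2.src ∨ iterBlockOf (c.1.1 : ℕ) x = c.1.2.tgt) → x ∈ cover P '' cube P.L a M ρ k 0
  · rw [if_pos hreach]
  · rw [if_neg hreach]
    -- a non-reaching cell has level `0` (§3) and then its kernel column vanishes at `b` (§2)
    obtain ⟨⟨⟨j, hj⟩, c₀⟩, hc₀⟩ := c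
    rcases Nat.eq_zero_or_pos j with rfl | hjpos
    · have hnr : ¬ (c₀.src ∈ cover P '' cube P.L a M ρ k 0 ∧ c₀.tgt ∈ cover P '' cube P.L a M ρ k 0) := by
        intro h
        apply hreach
        intro x hx
        rcases hx with hx | hx
        · rw [show x = c₀.src from hx]; exact h.1
        · rw [show x = c₀.tgt from hx]; exact h.2
      have h0 : flatH P kf _ (Pi.single (⟨⟨⟨0, hj⟩, c₀⟩, hc₀⟩ : BondIdx (domainsMeet (cubeDomains P a M ρ k hk) D₂)) (1 : ℝ)) b = 0 :=
        flatH_single_eq_zero_of_not_reach D₂ kf hk1 hρ hc₀ hnr 1 hb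
      rw [smul_zero, h0, zero_smul]
    · exact absurd (fun x hx => reach_of_lamBond_pos D₂ hρ hjpos hc₀ x hx) hreach

end Reach

end Summit.QuantumFields.YangMills.BalabanUVNodes.N07DPrimeReachDictionary

end
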